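import Summits.CriticalPhenomena.PercolationContinuityZ3.Theorems.PercNearOneGluingNoHeavyQuantFarSeparation
import Summits.CriticalPhenomena.PercolationContinuityZ3.Theorems.PercNearOneGluingNoHeavyQuantSecondWeightLevels
import HarnessLib

/-!
# QUANT lane R8: FAR AT LAYER ONE WHENEVER THE OBSERVER SPLITS THE RELAY SET — a layer-one counterexample to `Quant.FarRelayRow` has all its
# relays in ONE component of `G − o` (two independent relay blocks with ARBITRARY internal laws already satisfy the row)

builds on p205010 (kernel theorem, internal audit signed; external expert review pending)

Support file (`--supports stmt-CriticalPhenomena-4575`), seat `prim-cert-1` (gen 20); QUANT lane rung R8, front "FAR beyond trees" (lead g22).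
Generalises `Quant.farRelayRow_layerOne_of_separated` (`…QuantFarRelayRowSeparated`: one relay separated from the others) from a single separated
relay to an arbitrary separated GROUP: if `o ∉ S`, `w` vanishes on every pair between `S` and `Sᶜ ∖ {o}`, and both `A ∩ S` and `A ∖ S` are
nonempty, then the `j = 1` body of `Quant.FarRelayRow` holds.  Equivalently: **in a minimal layer-one counterexample to FAR the observer does
not separate the relay set** (all relays lie in one connected component of the support graph minus `o`).

* `Quant.twoBlock_reduce` — the real-algebra core: for two independent counts `C₁` (law `(z₁,s₁,t₁)` on `{0, 1, ≥2}`, `n₁` relays, mean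
  `m₁ ≤ s₁ + n₁t₁`, `n₁x ≤ m₁`) and `C` (law `(z,s,t)`, `n` relays, `s ≤ m ≤ s + nt`, `nx ≤ m`, `z ≤ 1 − x`) with `m₁ + m > 2`:
  `P(C₁ + C ≤ 1) = z₁(z + s) + s₁z ≤ 1 − x`.  PROOF: the law of group 1 enters linearly; on the line `s₁ + n₁t₁ = L` (`L ≥ n₁x`, `L > 2 − m`)
  the value is affine in `t₁ ∈ [(L−1)⁺/(n₁−1), L/n₁]`, and the endpoints are "glued" (`s₁ = 0`: `≤ 1 − L/n₁`), "Bernoulli" (`t₁ = 0`, `L ≤ 1`: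
  the single-relay inequality `x ≤ sx + t`, `Quant.SecondWeight.level_reduce` with `m > 2 − L ≥ 1`) and "never empty" (`z₁ = 0`, `L > 1`: `≤ z`).
  The worst laws ARE these three types (LP vertices); exact grid/random search (seat `num/groups_far1*.py`): min margin `0` (equality e.g. at
  `n₁ = 2`, `(z₁,s₁,t₁) = (.1,.9,0)`, `n = 3`, `(z,s,t) = (.6,0,.4)`: `P(N ≥ 2) = x = .4`).
* `Quant.farRelayRow_layerOne_of_twoBlocks` — **the `j = 1` instance of `Quant.FarRelayRow` on every finite weighted graph whose relay set is split
  by the observer**: `2 < Σ_{b∈A} P(o ↔ b)` and `P(o ↮ b) ≤ t` on `A` imply `P(#{b ∈ A | o ↔ b} ≤ 1) ≤ t`.  Plumbing: `…QuantFarSeparation`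
  (a.s. `o ↔ b` iff inside the side of `b`; sides determined by disjoint pair sets, hence independent; `Quant.count_bounds`).
No sorries; standard axioms.  [cite: KozmaNitzan2024, Lemma 2 (p. 6), Conjecture 3 (p. 15)] (the row); [cite: Grimmett1999, §1.3 p. 10; §2.2]
(product measure, independence of events on disjoint edge sets); the theorems [this work].
-/

noncomputable section

namespace Summit.CriticalPhenomena.PercolationContinuityZ3.Theorems

namespace Quant

open MeasureTheory Finset
open Literature.Probability.LatticeModels
open Literature.Probability.Percolation
open scoped Classical

variable {n : ℕ}

/-! ## The real-algebra core -/

/-- **Two-block layer-one inequality (real-algebra core).**  Two independent relay groups with count laws `(z₁, s₁, t₁)` = `P(C₁ = 0, = 1, ≥ 2)`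
(group of `n₁` relays, mean `m₁ ≤ s₁ + n₁ t₁`, `n₁ x ≤ m₁`) and `(z, s, t)` (group of `n` relays, `s ≤ m ≤ s + n t`, `n x ≤ m`, `z ≤ 1 − x`),
total mean `m₁ + m > 2`: then `P(C₁ + C ≤ 1) = z₁ (z + s) + s₁ z ≤ 1 − x`.  The law of group 1 enters linearly; along the line
`s₁ + n₁ t₁ = L` the three endpoint cases are "glued" (`s₁ = 0`), "Bernoulli" (`t₁ = 0`, `Quant.SecondWeight.level_reduce`) and "never empty"
(`z₁ = 0`). [this work] -/
theorem twoBlock_reduce (x z₁ s₁ t₁ m₁ z s t m : ℝ) (n₁ n : ℕ)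
    (hx : 0 < x) (hn₁ : 1 ≤ n₁) (hn : 1 ≤ n)
    (hz₁ : 0 ≤ z₁) (hs₁ : 0 ≤ s₁) (ht₁ : 0 ≤ t₁) (h1 : z₁ + s₁ + t₁ = 1) (hm₁ : m₁ ≤ s₁ + n₁ * t₁) (hx₁ : (n₁ : ℝ) * x ≤ m₁)
    (hz : 0 ≤ z) (hs : 0 ≤ s) (ht : 0 ≤ t) (h2 : z + s + t = 1) (hsm : s ≤ m) (hms : m ≤ s + n * t) (hnx : (n : ℝ) * x ≤ m)
    (hzx : z ≤ 1 - x) (hmean : 2 < m₁ + m) :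
    z₁ * (z + s) + s₁ * z ≤ 1 - x := by
  have hn₁' : (1 : ℝ) ≤ n₁ := by exact_mod_cast hn₁
  set L := s₁ + n₁ * t₁ with hL
  have hLx : (n₁ : ℝ) * x ≤ L := hx₁.trans hm₁
  have hxL : x ≤ L := by nlinarith
  have hLn : L ≤ n₁ := by rw [hL]; nlinarith
  set σ := (n₁ : ℝ) * s - (z + s) with hσ
  -- the target as a function on the line `s₁ = L − n₁ t₁`
  have hf : z₁ * (z + s) + s₁ * z = (z + s) - L * s + t₁ * σ := by
    have hz₁' : z₁ = 1 - s₁ - t₁ := by linarith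
    rw [hz₁', hσ, hL]; ring
  rw [hf]
  have hzs1 : z + s ≤ 1 := by linarith
  rcases le_or_gt 0 σ with hσ0 | hσ0
  · -- glued endpoint `t₁ = L / n₁`
    have ht₁L : (n₁ : ℝ) * t₁ ≤ L := by rw [hL]; linarith
    have h3 : (n₁ : ℝ) * t₁ * σ ≤ L * σ := mul_le_mul_of_nonneg_right ht₁L hσ0
    have h4 : (z + s) * ((n₁ : ℝ) - L) ≤ (n₁ : ℝ) - L := mul_le_of_le_one_left (by linarith) hzs1
    have hid : (n₁ : ℝ) * ((z + s) - L * s + t₁ * σ) = (z + s) * ((n₁ : ℝ) - L) + ((n₁ : ℝ) * t₁ * σ - L * σ) := by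
      rw [hσ]; ring
    have key : (n₁ : ℝ) * ((z + s) - L * s + t₁ * σ) ≤ (n₁ : ℝ) * (1 - x) := by
      rw [hid]; nlinarith
    exact le_of_mul_le_mul_left key (by linarith)
  · rcases le_or_gt L 1 with hL1 | hL1
    · -- Bernoulli endpoint `t₁ = 0`: the singleton inequality `x ≤ s x + t`
      have key := SecondWeight.level_reduce x 1 z s t m 0 x 1 n hx hn hz hs ht h2 hsm hms
        (by rw [one_mul]; exact hnx) le_rfl zero_le_one le_rfl le_rfl (le_trans hxL hL1)
      have hxst : x ≤ s * x + t := by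
        rcases key with h | ⟨_, h⟩
        · linarith
        · linarith
      have h5 : t₁ * σ ≤ 0 := mul_nonpos_of_nonneg_of_nonpos ht₁ hσ0.le
      have hsx : s * x ≤ L * s := by rw [mul_comm L s]; exact mul_le_mul_of_nonneg_left hxL hs
      linarith
    · -- never-empty endpoint `z₁ = 0`: the value there is `≤ z ≤ 1 − x`
      have ht₁L : L - 1 ≤ ((n₁ : ℝ) - 1) * t₁ := by rw [hL]; nlinarith
      have h6 : ((n₁ : ℝ) - 1) * t₁ * σ ≤ (L - 1) * σ := by nlinarith
      have hid : ((n₁ : ℝ) - 1) * ((z + s) - L * s + t₁ * σ - z) =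
          (((n₁ : ℝ) - 1) * t₁ * σ - (L - 1) * σ) + (L - 1) * (-z) := by
        rw [hσ]; ring
      have h7 : ((n₁ : ℝ) - 1) * ((z + s) - L * s + t₁ * σ - z) ≤ 0 := by
        rw [hid]
        have : (L - 1) * (-z) ≤ 0 := mul_nonpos_of_nonneg_of_nonpos (by linarith) (by linarith)
        linarith
      have hn1pos : (0 : ℝ) < (n₁ : ℝ) - 1 := by
        by_contra hle
        push Not at hle
        have : ((n₁ : ℝ) - 1) * t₁ ≤ 0 := mul_nonpos_of_nonpos_of_nonneg hle ht₁
        linarith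
      have h8 : (z + s) - L * s + t₁ * σ - z ≤ 0 := by
        by_contra hgt
        push Not at hgt
        have : 0 < ((n₁ : ℝ) - 1) * ((z + s) - L * s + t₁ * σ - z) := mul_pos hn1pos hgt
        linarith
      linarith

/-! ## The row -/

/-- **FAR AT LAYER ONE WHENEVER THE OBSERVER SPLITS THE RELAY SET** (the `j = 1` body of `Quant.FarRelayRow` for these weight functions):
`o ∉ S`, `w` vanishes on every pair between `S` and `Sᶜ ∖ {o}`, some relay lies in `S` and some relay lies off `S`.  Then
`2 < Σ_{b∈A} P(o ↔ b)` and `P(o ↮ b) ≤ t` for all `b ∈ A` imply `P(#{b ∈ A | o ↔ b} ≤ 1) ≤ t`. [this work] -/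
theorem farRelayRow_layerOne_of_twoBlocks (n : ℕ) (w : Sym2 (Fin n) → unitInterval) (A : Finset (Fin n)) (o : Fin n)
    (S : Set (Fin n)) (hoS : o ∉ S)
    (hsep : ∀ u v : Fin n, u ∈ S → v ∉ S → v ≠ o → w s(u, v) = 0)
    (hA₁ : ∃ a ∈ A, a ∈ S) (hA₂ : ∃ b ∈ A, b ∉ S)
    (t : ℝ) (hEN : (2 : ℝ) < ∑ b ∈ A, (prodBernoulli w).real (openConn o b))
    (hcut : ∀ b ∈ A, (prodBernoulli w).real (openConn o b : Set (BondConfig (Fin n)))ᶜ ≤ t) :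
    (prodBernoulli w).real {ω : BondConfig (Fin n) | (A.filter fun b => ω ∈ openConn o b).card ≤ 1} ≤ t := by
  set μ := prodBernoulli w with hμ
  have hmeas : ∀ X : Set (BondConfig (Fin n)), MeasurableSet X := fun X => (Set.toFinite X).measurableSet
  set A₁ : Finset (Fin n) := A.filter fun b => b ∈ S with hA₁def
  set B : Finset (Fin n) := A.filter fun b => b ∉ S with hBdef
  -- the inside events and counts
  set E₁ : Fin n → Set (BondConfig (Fin n)) := fun b => openConnIn (insert o S) o b with hE₁
  set E₂ : Fin n → Set (BondConfig (Fin n)) := fun b => openConnIn Sᶜ o b with hE₂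
  set c₁ : BondConfig (Fin n) → ℕ := fun ω => (A₁.filter fun b => ω ∈ E₁ b).card with hc₁
  set c₂ : BondConfig (Fin n) → ℕ := fun ω => (B.filter fun b => ω ∈ E₂ b).card with hc₂
  set T : Fin n → ℝ := fun b => μ.real (openConn o b) with hT
  have hA₁S : ∀ b ∈ A₁, b ∈ A ∧ b ∈ S := fun b hb => Finset.mem_filter.1 hb
  have hBS : ∀ b ∈ B, b ∈ A ∧ b ∉ S := fun b hb => Finset.mem_filter.1 hb
  -- a.s. identifications of the marginals
  have hE₁_eq : ∀ b ∈ A₁, μ.real (E₁ b) = T b := fun b hb =>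
    (WitnessSeparated.measureReal_congr_support w fun ω hω =>
      (openConn_iff_openConnIn_of_sep w S o hoS hsep hω (hA₁S b hb).2)).symm
  have hE₂_eq : ∀ b ∈ B, μ.real (E₂ b) = T b := fun b hb =>
    (WitnessSeparated.measureReal_congr_support w fun ω hω =>
      (openConn_iff_openConnIn_compl_of_sep w S o hoS hsep hω (hBS b hb).2)).symm
  -- determination by disjoint sets of pairs
  set F : Finset (Sym2 (Fin n)) := univ.filter fun e => (∀ z ∈ e, z ∈ insert o S) ∧ ¬ e.IsDiag with hF
  set F' : Finset (Sym2 (Fin n)) := univ.filter fun e => (∀ z ∈ e, z ∉ S) ∧ ¬ e.IsDiag with hF'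
  have hFF' : Disjoint F F' := by
    rw [Finset.disjoint_left]
    intro e he he'
    rw [hF, Finset.mem_filter] at he
    rw [hF', Finset.mem_filter] at he'
    induction e using Sym2.ind with
    | _ x y =>
      have hx : x ∈ insert o S := he.2.1 x (Sym2.mem_mk_left x y)
      have hy : y ∈ insert o S := he.2.1 y (Sym2.mem_mk_right x y)
      have hx' : x ∉ S := he'.2.1 x (Sym2.mem_mk_left x y)
      have hy' : y ∉ S := he'.2.1 y (Sym2.mem_mk_right x y)
      rw [Set.mem_insert_iff] at hx hy
      exact he.2.2 (Sym2.mk_isDiag_iff.2 ((hx.resolve_right hx').trans (hy.resolve_right hy').symm))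
  have hdet₁ : ∀ b, DeterminedBy (E₁ b) (↑F : Set (Sym2 (Fin n))) := by
    intro b
    refine determinedBy_openConnIn_of_pairs (insert o S) o b fun u v hu hv huv => ?_
    rw [Finset.mem_coe, hF, Finset.mem_filter]
    refine ⟨Finset.mem_univ _, fun z hz => ?_, fun hd => huv (Sym2.mk_isDiag_iff.1 hd)⟩
    rcases Sym2.mem_iff.1 hz with rfl | rfl
    · exact hu
    · exact hv
  have hdet₂ : ∀ b, DeterminedBy (E₂ b) (↑F' : Set (Sym2 (Fin n))) := by
    intro b
    refine determinedBy_openConnIn_of_pairs Sᶜ o b fun u v hu hv huv => ?_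
    rw [Finset.mem_coe, hF', Finset.mem_filter]
    refine ⟨Finset.mem_univ _, fun z hz => ?_, fun hd => huv (Sym2.mk_isDiag_iff.1 hd)⟩
    rcases Sym2.mem_iff.1 hz with rfl | rfl
    · exact hu
    · exact hv
  have hdetC₁ : ∀ P : ℕ → Prop, DeterminedBy {ω | P (c₁ ω)} (↑F : Set (Sym2 (Fin n))) := by
    intro P
    rw [determinedBy_iff]
    intro ω ω' hωω'
    have hc : c₁ ω = c₁ ω' := by
      simp only [hc₁]
      congr 1
      exact Finset.filter_congr fun b _ => (determinedBy_iff _ _).1 (hdet₁ b) ω ω' hωω'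
    simp only [Set.mem_setOf_eq, hc]
  have hdetC₂ : ∀ P : ℕ → Prop, DeterminedBy {ω | P (c₂ ω)} (↑F' : Set (Sym2 (Fin n))) := by
    intro P
    rw [determinedBy_iff]
    intro ω ω' hωω'
    have hc : c₂ ω = c₂ ω' := by
      simp only [hc₂]
      congr 1
      exact Finset.filter_congr fun b _ => (determinedBy_iff _ _).1 (hdet₂ b) ω ω' hωω'
    simp only [Set.mem_setOf_eq, hc]
  have hindep : ∀ P Q : ℕ → Prop, μ.real ({ω | P (c₁ ω)} ∩ {ω | Q (c₂ ω)}) = μ.real {ω | P (c₁ ω)} * μ.real {ω | Q (c₂ ω)} :=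
    fun P Q => prodBernoulli_real_inter_of_determinedBy_disjoint w hFF' (hdetC₁ P) (hdetC₂ Q) (hmeas _) (hmeas _)
  -- the relay count splits as `c₁ + c₂` almost surely
  have hN : μ.real {ω : BondConfig (Fin n) | (A.filter fun b => ω ∈ openConn o b).card ≤ 1} =
      μ.real (({ω | c₁ ω = 0} ∩ {ω | c₂ ω ≤ 1}) ∪ ({ω | c₁ ω = 1} ∩ {ω | c₂ ω = 0})) := by
    refine WitnessSeparated.measureReal_congr_support w fun ω hω => ?_
    have hfilt : (A.filter fun b => ω ∈ openConn o b).card = c₁ ω + c₂ ω := by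
      have hsplit := (Finset.card_filter_add_card_filter_not (s := A.filter fun b => ω ∈ openConn o b) (fun b => b ∈ S)).symm
      rw [hsplit, Finset.filter_filter, Finset.filter_filter]
      simp only [hc₁, hc₂]
      congr 1
      · rw [hA₁def, Finset.filter_filter]
        congr 1
        refine Finset.filter_congr fun b _ => ?_
        constructor
        · rintro ⟨h1, h2⟩; exact ⟨h2, (openConn_iff_openConnIn_of_sep w S o hoS hsep hω h2).1 h1⟩
        · rintro ⟨h2, h1⟩; exact ⟨(openConn_iff_openConnIn_of_sep w S o hoS hsep hω h2).2 h1, h2⟩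
      · rw [hBdef, Finset.filter_filter]
        congr 1
        refine Finset.filter_congr fun b _ => ?_
        constructor
        · rintro ⟨h1, h2⟩; exact ⟨h2, (openConn_iff_openConnIn_compl_of_sep w S o hoS hsep hω h2).1 h1⟩
        · rintro ⟨h2, h1⟩; exact ⟨(openConn_iff_openConnIn_compl_of_sep w S o hoS hsep hω h2).2 h1, h2⟩
    simp only [Set.mem_setOf_eq, Set.mem_union, Set.mem_inter_iff, hfilt]
    omega
  have hdisjU : Disjoint ({ω | c₁ ω = 0} ∩ {ω | c₂ ω ≤ 1}) ({ω : BondConfig (Fin n) | c₁ ω = 1} ∩ {ω | c₂ ω = 0}) := by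
    rw [Set.disjoint_left]
    rintro ω ⟨h1', -⟩ ⟨h2', -⟩
    simp only [Set.mem_setOf_eq] at h1' h2'
    omega
  rw [hN, measureReal_union hdisjU (hmeas _), hindep (fun c => c = 0) (fun c => c ≤ 1), hindep (fun c => c = 1) (fun c => c = 0)]
  -- the numbers
  set z₁ := μ.real {ω | c₁ ω = 0} with hz₁
  set s₁ := μ.real {ω | c₁ ω = 1} with hs₁
  set t₁ := μ.real {ω | 2 ≤ c₁ ω} with ht₁
  set z := μ.real {ω | c₂ ω = 0} with hz
  set s := μ.real {ω | c₂ ω = 1} with hs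
  set t₂ := μ.real {ω | 2 ≤ c₂ ω} with ht₂
  set m₁ := ∑ b ∈ A₁, T b with hm₁
  set m := ∑ b ∈ B, T b with hm
  have htri : ∀ c : BondConfig (Fin n) → ℕ, μ.real {ω | c ω = 0} + μ.real {ω | c ω = 1} + μ.real {ω | 2 ≤ c ω} = 1 ∧
      μ.real {ω | c ω ≤ 1} = μ.real {ω | c ω = 0} + μ.real {ω | c ω = 1} := by
    intro c
    have hd01 : Disjoint {ω : BondConfig (Fin n) | c ω = 0} {ω | c ω = 1} := by
      rw [Set.disjoint_left]; intro ω h0 h1'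
      simp only [Set.mem_setOf_eq] at h0 h1'; omega
    have hd2 : Disjoint ({ω : BondConfig (Fin n) | c ω = 0} ∪ {ω | c ω = 1}) {ω | 2 ≤ c ω} := by
      rw [Set.disjoint_left]; intro ω h01 h2'
      simp only [Set.mem_setOf_eq, Set.mem_union] at h01 h2'; omega
    have huniv : {ω : BondConfig (Fin n) | c ω = 0} ∪ {ω | c ω = 1} ∪ {ω | 2 ≤ c ω} = Set.univ := by
      ext ω; simp only [Set.mem_union, Set.mem_setOf_eq, Set.mem_univ, iff_true]; omega
    have hle : {ω : BondConfig (Fin n) | c ω ≤ 1} = {ω | c ω = 0} ∪ {ω | c ω = 1} := by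
      ext ω; simp only [Set.mem_union, Set.mem_setOf_eq]; omega
    constructor
    · rw [← measureReal_union hd01 (hmeas _), ← measureReal_union hd2 (hmeas _), huniv, probReal_univ]
    · rw [hle, measureReal_union hd01 (hmeas _)]
  obtain ⟨hzst₁, hle₁⟩ := htri c₁
  obtain ⟨hzst₂, hle₂⟩ := htri c₂
  rw [hle₂]
  -- mean, floor
  have hAsplit : ∑ b ∈ A, T b = m₁ + m := by
    rw [hm₁, hm, hA₁def, hBdef]
    exact (Finset.sum_filter_add_sum_filter_not A (fun b => b ∈ S) T).symm
  have hcut' : ∀ b ∈ A, 1 - t ≤ T b := by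
    intro b hb
    have := hcut b hb
    rw [probReal_compl_eq_one_sub (hmeas _)] at this
    simp only [hT]; linarith
  -- counting bounds on both sides
  have hcb₁ := count_bounds μ A₁ E₁ (fun b _ => hmeas _) (hmeas _) (hmeas _)
  have hcb₂ := count_bounds μ B E₂ (fun b _ => hmeas _) (hmeas _) (hmeas _)
  rw [Finset.sum_congr rfl fun b hb => hE₁_eq b hb] at hcb₁
  rw [Finset.sum_congr rfl fun b hb => hE₂_eq b hb] at hcb₂
  obtain ⟨hsm₁, hms₁⟩ := hcb₁
  obtain ⟨hsm₂, hms₂⟩ := hcb₂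
  obtain ⟨a, haA, haS⟩ := hA₁
  obtain ⟨b₀, hb₀A, hb₀S⟩ := hA₂
  have ha₁ : a ∈ A₁ := Finset.mem_filter.2 ⟨haA, haS⟩
  have hb₀ : b₀ ∈ B := Finset.mem_filter.2 ⟨hb₀A, hb₀S⟩
  have hn₁ : 1 ≤ A₁.card := Finset.card_pos.2 ⟨a, ha₁⟩
  have hn₂ : 1 ≤ B.card := Finset.card_pos.2 ⟨b₀, hb₀⟩
  have hnx₁ : (A₁.card : ℝ) * (1 - t) ≤ m₁ := by
    have : ∑ b ∈ A₁, (1 - t) ≤ ∑ b ∈ A₁, T b := Finset.sum_le_sum fun b hb => hcut' b (hA₁S b hb).1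
    rwa [Finset.sum_const, nsmul_eq_mul] at this
  have hnx₂ : (B.card : ℝ) * (1 - t) ≤ m := by
    have : ∑ b ∈ B, (1 - t) ≤ ∑ b ∈ B, T b := Finset.sum_le_sum fun b hb => hcut' b (hBS b hb).1
    rwa [Finset.sum_const, nsmul_eq_mul] at this
  -- `z ≤ 1 − x`: the empty count misses `b₀`
  have hzx : z ≤ 1 - (1 - t) := by
    have hsub : {ω : BondConfig (Fin n) | c₂ ω = 0} ⊆ (E₂ b₀)ᶜ := by
      intro ω hω hωb
      simp only [Set.mem_setOf_eq, hc₂] at hω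
      have : b₀ ∈ B.filter fun b => ω ∈ E₂ b := Finset.mem_filter.2 ⟨hb₀, hωb⟩
      rw [Finset.card_eq_zero] at hω
      rw [hω] at this
      exact Finset.notMem_empty _ this
    have := measureReal_mono (μ := μ) hsub (measure_ne_top _ _)
    rw [probReal_compl_eq_one_sub (hmeas _), hE₂_eq b₀ hb₀] at this
    linarith [hcut' b₀ hb₀A]
  have hmean : 2 < m₁ + m := by rw [← hAsplit]; exact hEN
  by_cases hxpos : 0 < 1 - t
  · have key := twoBlock_reduce (1 - t) z₁ s₁ t₁ m₁ z s t₂ m A₁.card B.card hxpos hn₁ hn₂ measureReal_nonneg measureReal_nonneg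
      measureReal_nonneg hzst₁ hms₁ hnx₁ measureReal_nonneg measureReal_nonneg measureReal_nonneg hzst₂ hsm₂ hms₂ hnx₂ hzx hmean
    rw [← hz, ← hs]
    linarith
  · push Not at hxpos
    rw [← hz, ← hs]
    have h1 : z₁ * (z + s) + s₁ * z ≤ z₁ + s₁ := by
      have hzs : z + s ≤ 1 := by linarith [hzst₂, (measureReal_nonneg : 0 ≤ t₂)]
      have hz1 : z ≤ 1 := by linarith [hzst₂, (measureReal_nonneg : 0 ≤ s), (measureReal_nonneg : 0 ≤ t₂)]
      nlinarith [(measureReal_nonneg : 0 ≤ z₁), (measureReal_nonneg : 0 ≤ s₁)]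
    linarith [hzst₁, (measureReal_nonneg : 0 ≤ t₁)]

end Quant

end Summit.CriticalPhenomena.PercolationContinuityZ3.Theorems

end
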